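import Summits.ValiantsHypothesis.ValiantsHypothesis.Theorems.TwoAdicLadderPrecisionLadderLadderZCalibration
import Summits.ValiantsHypothesis.ValiantsHypothesis.Theorems.TwoAdicLadderTwoIntegralNormalisationHalfElimKernel
import Summits.ValiantsHypothesis.ValiantsHypothesis.Theorems.TwoAdicLadderPrecisionLadderLadderZRungs

/-!
# TwoAdicLadder — crux `PrecisionLadder` (stmt-ValiantsHypothesis-5948), line `birth`,
# registered stub `stub_ladderZ`: crux ⇒ stub, and the witness precision must tend to infinity
# (the route-dependent half of the calibration: uses items `PrecisionLadder`, `CeilingAllPrecisions`)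

The registered open stub of `Cruxes/PrecisionLadder/Lines/birth.lean`,

  `stub_ladderZ : ∀ c, ∃ᶠ n in atTop, ∃ k, n ^ c < complexity (perPoly (Fin n) (ZMod (2 ^ (k + 1))))`.

* `ladderZ_of_precisionLadder` — the crux `PrecisionLadder` implies the stub (`ℤ/2^(k+1)` is
  admissible at precision `k`: tree `zmod_two_pow_succ_admissible`); the converse is exactly the
  line's `stub_localise` (landed) `+ stub_descent` (open).
* `complexity_perPoly_zmod_two_pow_le_uniform`, `ladderZ_witness_precision_gt` — by the tree's
  `ceilingAllPrecisions_proof` (per is p-computable over `ℤ/2^k` for every FIXED `k`) no bounded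
  precision ever witnesses a rung: for every `K` there is `c₀` such that at every rung `c ≥ c₀`,
  eventually in `n`, every witness `k` of the stub has `K < k + 1`.  With monotonicity in `k`
  (`…LadderZCalibration.lean`) the stub reads: the bounded monotone sequence
  `k ↦ L_{ℤ/2^k}(per_n)` (limit `= L_{ℤ₂}(per_n)` up to a polynomial, `…LadderZTwoAdic.lean`)
  climbs above every `n^c` — but only at precisions `k(n) → ∞`.

* `ladderZ_of_precisionwise_exponent_unbounded`, `ladderZ_of_digitCost` — QUANTIFIER SHAPES: the
  precision-wise form `∀ a ∃ k ∃ᶠ n` ("the exponent `a(k)` of `CeilingAllPrecisions` is unbounded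
  in `k`", the algebraic shadow of fixed-parameter intractability of per mod `2^k`) and the route
  header's parked `DigitCost` split both IMPLY the stub; neither is implied by VH by any argument in
  the tree (the stub chooses `k` after `n`), so they are stronger-shaped, summit-uncalibrated forms.

Route-independent halves: `…LadderZCalibration.lean`, `…LadderZTwoAdic.lean`, `…LadderZVH.lean`,
`…LadderZRungs.lean`.  Honest framing: no rung is proved here; the stub, the crux and `VP ≠ VNP`
are NOT proved and nothing here is progress on them.  No new definitions, no named facts, no sorry.

## References

* L. G. Valiant, *The complexity of computing the permanent*, TCS 8 (1979), §4 (per mod `2^k` in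
  polynomial time for fixed `k`). [cite: Valiant1979Permanent, §4]
-/

noncomputable section

open MvPolynomial

-- the summit and the problem share the name `ValiantsHypothesis` (D-0017 single-conjunct layout)
set_option linter.dupNamespace false

namespace Summit.ValiantsHypothesis.ValiantsHypothesis.Theorems.TwoAdicLadderPrecisionLadder

open Filter Literature.Computability.AlgebraicComplexity
open Summit.ValiantsHypothesis.ValiantsHypothesis.Theses.TwoAdicLadder

/-! ### §1. The stub is below the crux -/

/-- **Crux ⇒ stub.** `PrecisionLadder` quantifies over all rings admissible at precision `k`;
`ℤ/2^(k+1)` is one of them (finite, principal, `2` nilpotent, `2^k ≠ 0`: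
`zmod_two_pow_succ_admissible`). [folklore] -/
theorem ladderZ_of_precisionLadder (h : PrecisionLadder) :
    ∀ c : ℕ, ∃ᶠ n in atTop, ∃ k : ℕ,
      n ^ c < complexity (perPoly (Fin n) (ZMod (2 ^ (k + 1)))) := by
  unfold Theses.TwoAdicLadder.PrecisionLadder at h
  intro c
  refine (h c).mono ?_
  rintro n ⟨k, hk⟩
  obtain ⟨hPIR, hnil, hne⟩ := TwoAdicLadder.TwoIntegralNormalisation.zmod_two_pow_succ_admissible k
  exact ⟨k, hk (ZMod (2 ^ (k + 1))) hPIR hnil hne⟩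

/-! ### §2. No bounded precision witnesses a rung (CeilingAllPrecisions) -/

/-- **Bounded precision is uniformly cheap.** For every `K` there is one exponent `a` with
`L_{ℤ/2^k}(per_n) ≤ n^a + a` for all `n` and all `k ≤ K` (tree `ceilingAllPrecisions_proof` at the
top precision `K`, then monotonicity). [cite: Valiant1979Permanent, §4] -/
theorem complexity_perPoly_zmod_two_pow_le_uniform (K : ℕ) :
    ∃ a : ℕ, ∀ n k : ℕ, k ≤ K → complexity (perPoly (Fin n) (ZMod (2 ^ k))) ≤ n ^ a + a := by
  obtain ⟨a, ha⟩ := TwoAdicLadder.ceilingAllPrecisions_proof K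
  exact ⟨a, fun n k hk => (complexity_perPoly_zmod_two_pow_mono n hk).trans (ha n)⟩

/-- **The witness precision must tend to infinity.** For every `K` there is a rung `c₀` such that
at every rung `c ≥ c₀`, for all large `n`, any precision `k` with
`n ^ c < L_{ℤ/2^(k+1)}(per_n)` satisfies `K < k + 1`: in the stub, hardness can only come from
`k → ∞` (the ladder is a ladder, not a cliff). [cite: Valiant1979Permanent, §4] -/
theorem ladderZ_witness_precision_gt (K : ℕ) :
    ∃ c₀ : ℕ, ∀ c : ℕ, c₀ ≤ c → ∀ᶠ n in atTop, ∀ k : ℕ,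
      n ^ c < complexity (perPoly (Fin n) (ZMod (2 ^ (k + 1)))) → K < k + 1 := by
  obtain ⟨a, ha⟩ := complexity_perPoly_zmod_two_pow_le_uniform K
  refine ⟨a + 1, fun c hc => ?_⟩
  filter_upwards [eventually_ge_atTop (a + 1)] with n hn k hk
  by_contra hK
  push Not at hK
  have hpos : 0 < n ^ a := pow_pos (by omega) a
  have h1 : a ≤ a * n ^ a := Nat.le_mul_of_pos_right a hpos
  have hle : n ^ a + a ≤ n ^ c :=
    calc n ^ a + a ≤ n ^ a + a * n ^ a := by omega
      _ = (a + 1) * n ^ a := by ring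
      _ ≤ n * n ^ a := Nat.mul_le_mul_right _ hn
      _ = n ^ (a + 1) := by ring
      _ ≤ n ^ c := Nat.pow_le_pow_right (by omega) hc
  exact absurd (hk.trans_le ((ha n (k + 1) hK).trans hle)) (lt_irrefl _)

/-! ### §3. Quantifier shapes: the stub (`∃ k` after `n`) versus the precision-wise / DigitCost forms -/

/-- **The precision-wise ("fixed-parameter") form implies the stub.** If for every exponent `a` a
SINGLE precision `k` defeats it — `∃ᶠ n, n ^ a < L_{ℤ/2^(k+1)}(per_n)`, i.e. the exponent `a(k)` of
`CeilingAllPrecisions` is unbounded in `k` (the algebraic shadow of "per mod `2^k` is not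
fixed-parameter tractable in `k`") — then `stub_ladderZ` holds (there the precision is chosen AFTER
`n`). The converse is NOT claimed and not expected to be provable by calibration: VH implies the stub
(`…LadderZVH.lean`) but is not known to imply this form — a uniform exponent `a` valid at every
precision only beyond thresholds `n₀(k) → ∞` is compatible with `L_{ℤ₂}(per_n)` exponential. So a
split of the crux through a precision-wise statement would put a claim on the critical path that is
not calibrated against the summit. [folklore] -/
theorem ladderZ_of_precisionwise_exponent_unbounded
    (h : ∀ a : ℕ, ∃ k : ℕ, ∃ᶠ n in atTop,
      n ^ a < complexity (perPoly (Fin n) (ZMod (2 ^ (k + 1))))) :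
    ∀ c : ℕ, ∃ᶠ n in atTop, ∃ k : ℕ,
      n ^ c < complexity (perPoly (Fin n) (ZMod (2 ^ (k + 1)))) := by
  intro c
  obtain ⟨k, hk⟩ := h c
  exact hk.mono fun n hn => ⟨k, hn⟩

/-- The precision-wise form, unfolded: it is the negation of "ONE exponent `a` serves every
precision, each eventually in `n` (threshold depending on `k`)" — compare `CeilingAllPrecisions`,
which gives for every `k` SOME exponent `a(k)`. [folklore] -/
theorem precisionwise_exponent_unbounded_iff :
    (∀ a : ℕ, ∃ k : ℕ, ∃ᶠ n in atTop,
        n ^ a < complexity (perPoly (Fin n) (ZMod (2 ^ (k + 1))))) ↔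
      ¬ ∃ a : ℕ, ∀ k : ℕ, ∀ᶠ n in atTop,
        complexity (perPoly (Fin n) (ZMod (2 ^ (k + 1)))) ≤ n ^ a := by
  simp only [not_exists, not_forall, not_eventually, not_le]

/-- **The route header's parked `DigitCost` split implies the stub** (prime-ring version of
"`∀ k ∃ k' > k`: `L_{k'}(n) ≥ n · L_k(n)` eventually — some later `2`-adic digit always costs a
factor `n`"): iterating from precision `0` gives, for every `a`, one precision `k_a` with
`n ^ a < L_{ℤ/2^(k_a+1)}(per_n)` for all large `n` (using `L_{ℤ/2}(per_n) ≥ 1` for `n ≥ 3`,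
input counting, `lt_complexity_perPoly_zmod`), hence the precision-wise form,
hence the stub. Like the precision-wise form, `DigitCost` is NOT implied by VH by any argument in the
tree; this lemma only records the direction `DigitCost ⇒ stub_ladderZ`. [folklore] -/
theorem ladderZ_of_digitCost
    (h : ∀ k : ℕ, ∃ k' : ℕ, k < k' ∧ ∀ᶠ n in atTop,
      n * complexity (perPoly (Fin n) (ZMod (2 ^ (k + 1)))) ≤
        complexity (perPoly (Fin n) (ZMod (2 ^ (k' + 1))))) :
    ∀ c : ℕ, ∃ᶠ n in atTop, ∃ k : ℕ,
      n ^ c < complexity (perPoly (Fin n) (ZMod (2 ^ (k + 1)))) := by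
  -- for every `a`: a precision `k` with `n ^ a * L_{ℤ/2}(per_n) ≤ L_{ℤ/2^(k+1)}(per_n)` eventually
  have step : ∀ a : ℕ, ∃ k : ℕ, ∀ᶠ n in atTop,
      n ^ a * complexity (perPoly (Fin n) (ZMod (2 ^ (0 + 1)))) ≤
        complexity (perPoly (Fin n) (ZMod (2 ^ (k + 1)))) := by
    intro a
    induction a with
    | zero => exact ⟨0, Eventually.of_forall fun n => by rw [pow_zero, one_mul]⟩
    | succ a ih =>
      obtain ⟨k, hk⟩ := ih
      obtain ⟨k', -, hk'⟩ := h k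
      refine ⟨k', ?_⟩
      filter_upwards [hk, hk'] with n hn hn'
      calc n ^ (a + 1) * complexity (perPoly (Fin n) (ZMod (2 ^ (0 + 1))))
          = n * (n ^ a * complexity (perPoly (Fin n) (ZMod (2 ^ (0 + 1))))) := by ring
        _ ≤ n * complexity (perPoly (Fin n) (ZMod (2 ^ (k + 1)))) := Nat.mul_le_mul_left _ hn
        _ ≤ complexity (perPoly (Fin n) (ZMod (2 ^ (k' + 1)))) := hn'
  refine ladderZ_of_precisionwise_exponent_unbounded fun a => ?_
  obtain ⟨k, hk⟩ := step (a + 1)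
  refine ⟨k, Eventually.frequently ?_⟩
  filter_upwards [hk, eventually_ge_atTop 3] with n hn hn3
  -- `L_{ℤ/2}(per_n) ≥ 1` for `n ≥ 3` (input counting, `lt_complexity_perPoly_zmod`)
  have hL : 1 ≤ complexity (perPoly (Fin n) (ZMod (2 ^ (0 + 1)))) :=
    le_of_lt (lt_of_le_of_lt (by omega) (lt_complexity_perPoly_zmod hn3 0))
  calc n ^ a < n ^ (a + 1) := Nat.pow_lt_pow_right (by omega) (by omega)
    _ ≤ n ^ (a + 1) * complexity (perPoly (Fin n) (ZMod (2 ^ (0 + 1)))) :=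
        Nat.le_mul_of_pos_right _ hL
    _ ≤ complexity (perPoly (Fin n) (ZMod (2 ^ (k + 1)))) := hn

end Summit.ValiantsHypothesis.ValiantsHypothesis.Theorems.TwoAdicLadderPrecisionLadder

end
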